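import Literature.Probability.RandomPlanarGeometry.ObliqueRBMWedgeTestFun
import Literature.Probability.RandomPlanarGeometry.ObliqueRBMWedgeApex
import Literature.Probability.RandomPlanarGeometry.ObliqueRBMWedgeDynkinSum
import Mathlib.MeasureTheory.Measure.HasOuterApproxClosed
import HarnessLib

/-!
# Proof of `LawlerSchrammWerner2001_orbm_uniformHitting` (uniform hitting law of `ORBM_{π/3}`)

This file discharges the named fact
`Literature.Probability.RandomPlanarGeometry.LawlerSchrammWerner2001_orbm_uniformHitting`
(`ObliqueRBMWedge.lean`; Lawler–Schramm–Werner 2001 §3, Dubédat 2004 §4 Prop. 1, Werner LNM 1840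
Lemma 5.3): `theorem LawlerSchrammWerner2001_orbm_uniformHitting_holds` at the end of the file.
It assembles the layers `ObliqueRBMWedgeSkorokhod/Flow/Canonical/Density/Dynkin/DynkinSum`
(canonical model and stopped Dynkin identity), `…Kernel/HalfPlane/Boundary/Conformal/Pullback/TestFun`
(explicit oblique harmonic test functions via the Schwarz–Christoffel map of the equilateral
triangle), `…Beta/Apex/Identify` (Carleson–Euler identity, trace/apex identities, identification of
the uniform law) in three parts:

1. the quadratic oblique test function `F₂ = Re(κ z²)` (exact boundary conditions; its side values
   are affine in the side parameter, which pins down the mean of the hitting parameter);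
2. the canonical model: hitting time/position of the opposite side, `E[F(Z_{T_N})] = F(0)` for both
   families of test functions by `t → ∞`, `M ↑ N` in the stopped Dynkin identity, and the resulting
   uniform law of the hitting position (`hasLaw_hitPos`);
3. the transfer to an arbitrary solution of the Skorokhod problem `IsORBMSixty` through measurable
   dyadic-skeleton functionals of the driving pair of Brownian paths (whose law is `wienerPair`).

## References

* G. F. Lawler, O. Schramm, W. Werner, *Values of Brownian intersection exponents I: Half-plane
  exponents*, Acta Math. 187 (2001), §3.
* J. Dubédat, *Reflected planar Brownian motions, intertwining relations and crossing
  probabilities*, Ann. Inst. H. Poincaré Probab. Statist. 40 (2004), 539–552, §4. [Dubedat2004]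
* W. Werner, *Random planar curves and Schramm–Loewner evolutions*, LNM 1840 (2004), Ch. 5 §5.1,
  Lemma 5.3. [WernerStFlour2004]
-/

/-!
# The quadratic oblique test function `F₂(z) = Re(e^{-5iπ/6} z²)`

Layer of the proof of
`Literature.Probability.RandomPlanarGeometry.LawlerSchrammWerner2001_orbm_uniformHitting`
(`ObliqueRBMWedge.lean`). The harmonic polynomial `F₂(z) = Re(κ z²)`, `κ = e^{-5iπ/6} = -ζ̄ i`,
satisfies the oblique boundary conditions of the `ORBM` EXACTLY (`∂_ζ F₂ = 0` on the side
`quadY = 0`, `∂₁ F₂ = 0` on the side `quadX = 0`), its second-order Taylor expansion is exact, and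
on the opposite side `F₂(N((1−s) + sζ)) = N² √3 (s − 1/2)` is affine in `s`. We package it (clamped
to the closed triangle, `0` outside) as a term `quadData : OrbmTestData M'`.

## References

* J. Dubédat, Ann. IHP 40 (2004), §4 (harmonic polynomials with oblique Neumann conditions).
  [Dubedat2004]
-/

noncomputable section

open Set Filter Topology Complex Metric MeasureTheory
open scoped Real

namespace Literature.Probability.RandomPlanarGeometry

/-- The constant `κ = e^{-5iπ/6} = (−√3/2) − i/2`. [folklore] -/
def kappa : ℂ := ⟨-(Real.sqrt 3 / 2), -(1 / 2)⟩

/-- **The quadratic test polynomial** `F₂(z) = Re(κ z²)`. [folklore] -/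
def quadPoly (z : ℂ) : ℝ := (kappa * z ^ 2).re

/-- Auxiliary statement (`quadPoly_eq`). [folklore] -/
theorem quadPoly_eq (z : ℂ) : quadPoly z = -(Real.sqrt 3 / 2) * (z.re ^ 2 - z.im ^ 2) + z.re * z.im := by
  simp only [quadPoly, kappa, mul_re, sq, mul_im]
  ring

/-- Auxiliary statement (`continuous_quadPoly`). [folklore] -/
theorem continuous_quadPoly : Continuous quadPoly := by
  have : quadPoly = fun z : ℂ ↦ -(Real.sqrt 3 / 2) * (z.re ^ 2 - z.im ^ 2) + z.re * z.im := funext quadPoly_eq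
  rw [this]; fun_prop

/-- Auxiliary statement (`re_oppositeSideParam`). [folklore] -/
theorem re_oppositeSideParam (N s : ℝ) : (oppositeSideParam N s).re = N * (1 - s / 2) := by
  rw [oppositeSideParam, dirSixty_eq]
  simp only [mul_re, mul_im, add_re, add_im, sub_re, sub_im, ofReal_re, ofReal_im, one_re, one_im]
  ring

/-- Auxiliary statement (`im_oppositeSideParam`). [folklore] -/
theorem im_oppositeSideParam (N s : ℝ) : (oppositeSideParam N s).im = N * (s * (Real.sqrt 3 / 2)) := by
  rw [oppositeSideParam, dirSixty_eq]
  simp only [mul_re, mul_im, add_re, add_im, sub_re, sub_im, ofReal_re, ofReal_im, one_re, one_im]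
  ring

/-- **Values on the opposite side**: `F₂(N((1−s) + sζ)) = N² √3 (s − 1/2)`. [folklore] -/
theorem quadPoly_oppositeSideParam (N s : ℝ) : quadPoly (oppositeSideParam N s) = N ^ 2 * (Real.sqrt 3 * (s - 1 / 2)) := by
  rw [quadPoly_eq]
  rw [re_oppositeSideParam, im_oppositeSideParam]
  have h3 := sqrt3_mul_self
  linear_combination (N ^ 2 * s ^ 2 * Real.sqrt 3 / 8) * h3

/-- Auxiliary statement: the exact value recomputed (`quadPoly_oppositeSideParam'`). [folklore] -/
theorem quadPoly_oppositeSideParam' (N s : ℝ) :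
    quadPoly (oppositeSideParam N s) = -(Real.sqrt 3 / 2) * ((N * (1 - s / 2)) ^ 2 - (N * (s * (Real.sqrt 3 / 2))) ^ 2)
      + N * (1 - s / 2) * (N * (s * (Real.sqrt 3 / 2))) := by
  rw [quadPoly_eq, re_oppositeSideParam, im_oppositeSideParam]

/-- Auxiliary statement (`norm_kappa`). [folklore] -/
theorem norm_kappa : ‖kappa‖ = 1 := by
  have h : ‖kappa‖ ^ 2 = 1 := by
    rw [← Complex.normSq_eq_norm_sq, kappa, Complex.normSq_mk]
    have := sqrt3_mul_self
    nlinarith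
  have hn : 0 ≤ ‖kappa‖ := norm_nonneg _
  nlinarith

/-- Auxiliary statement (`abs_quadPoly_le`). [folklore] -/
theorem abs_quadPoly_le (z : ℂ) : |quadPoly z| ≤ ‖z‖ ^ 2 := by
  rw [quadPoly]
  refine (abs_re_le_norm _).trans ?_
  rw [norm_mul, norm_kappa, one_mul, norm_pow]

open scoped Classical in
/-- **The clamped quadratic test function** (`quadPoly` on `levelRegion N`, `0` outside).
[folklore] -/
def quadF (N : ℝ) : ℂ → ℝ := (levelRegion N).piecewise quadPoly fun _ ↦ 0

/-- Auxiliary statement (`quadF_of_mem`). [folklore] -/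
theorem quadF_of_mem {N : ℝ} {z : ℂ} (hz : z ∈ levelRegion N) : quadF N z = quadPoly z := by
  classical
  exact piecewise_eq_of_mem _ _ _ hz

/-- Auxiliary statement (`quadF_of_not_mem`). [folklore] -/
theorem quadF_of_not_mem {N : ℝ} {z : ℂ} (hz : z ∉ levelRegion N) : quadF N z = 0 := by
  classical
  exact piecewise_eq_of_notMem _ _ _ hz

/-- Auxiliary statement (`measurable_quadF`). [folklore] -/
theorem measurable_quadF (N : ℝ) : Measurable (quadF N) := by
  classical
  unfold quadF
  exact ContinuousOn.measurable_piecewise continuous_quadPoly.continuousOn continuousOn_const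
    (isClosed_levelRegion N).measurableSet

/-- Auxiliary statement (`continuousOn_quadF`). [folklore] -/
theorem continuousOn_quadF (N : ℝ) : ContinuousOn (quadF N) (levelRegion N) :=
  continuous_quadPoly.continuousOn.congr fun _ hz ↦ quadF_of_mem hz

/-- Auxiliary statement (`abs_quadF_le`). [folklore] -/
theorem abs_quadF_le (N : ℝ) (z : ℂ) : |quadF N z| ≤ N ^ 2 := by
  by_cases hz : z ∈ levelRegion N
  · rw [quadF_of_mem hz]
    refine (abs_quadPoly_le z).trans ?_
    have h := (norm_le_level hz.1 hz.2.1).trans hz.2.2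
    exact pow_le_pow_left₀ (norm_nonneg _) h 2
  · rw [quadF_of_not_mem hz, abs_zero]; positivity

/-- **`F₂(0) = 0`.** [folklore] -/
theorem quadF_zero {N : ℝ} (hN : 0 ≤ N) : quadF N 0 = 0 := by
  rw [quadF_of_mem ⟨by simp [quadX], by simp [quadY], by simp [quadX, quadY]; exact hN⟩, quadPoly_eq]; simp

/-- **`F₂` on the opposite side**: `F₂(N((1−s)+sζ)) = N²√3(s − 1/2)` for `s ∈ [0,1]`. [folklore] -/
theorem quadF_oppositeSideParam {N : ℝ} (hN : 0 < N) {s : ℝ} (hs : s ∈ Icc (0:ℝ) 1) :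
    quadF N (oppositeSideParam N s) = N ^ 2 * (Real.sqrt 3 * (s - 1 / 2)) := by
  have hmem : oppositeSideParam N s ∈ levelRegion N := by
    refine ⟨?_, ?_, ?_⟩
    · rw [quadX_oppositeSideParam]; exact mul_nonneg hN.le (by linarith [hs.2])
    · rw [quadY_oppositeSideParam]; exact mul_nonneg hN.le hs.1
    · rw [quadX_oppositeSideParam, quadY_oppositeSideParam]; linarith
  rw [quadF_of_mem hmem, quadPoly_oppositeSideParam]

/-- `im z = (√3/2) quadY z` and `re z = quadX z + quadY z / 2`. [folklore] -/
theorem im_eq_quadY (z : ℂ) : z.im = Real.sqrt 3 / 2 * quadY z := by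
  rw [quadY]; have h3 := sqrt3_pos; field_simp

/-- Auxiliary statement (`re_eq_quad`). [folklore] -/
theorem re_eq_quad (z : ℂ) : z.re = quadX z + quadY z / 2 := by
  rw [quadX, quadY]; have h3 := sqrt3_pos; field_simp; ring

/-- **The quadratic test data** for the stopped Dynkin identity, at every level `0 < M' ≤ N`.
[folklore] -/
def quadData {N M' : ℝ} (hM'0 : 0 < M') (hM' : M' ≤ N) : OrbmTestData M' where
  F := quadF N
  f₁ z := -Real.sqrt 3 * z.re + z.im
  f₂ z := Real.sqrt 3 * z.im + z.re
  f₁₁ _ := -Real.sqrt 3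
  f₁₂ _ := 1
  f₂₂ _ := Real.sqrt 3
  C_F := N ^ 2
  C₁ := 3 * M' + 2
  C₂ := Real.sqrt 3
  ωbar := 0
  ω _ := 0
  measurableF := measurable_quadF N
  absF_le := abs_quadF_le N
  abs_f₁_le z hz := by
    have hzn : ‖z‖ ≤ M' := (norm_le_level hz.1 hz.2.1).trans hz.2.2
    have h1 := abs_re_le_norm z; have h2 := abs_im_le_norm z
    have h3 : Real.sqrt 3 < 2 := by
      have := sqrt3_mul_self; nlinarith [sqrt3_pos]
    calc |-Real.sqrt 3 * z.re + z.im| ≤ |-Real.sqrt 3 * z.re| + |z.im| := abs_add_le _ _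
      _ = Real.sqrt 3 * |z.re| + |z.im| := by rw [abs_mul, abs_neg, abs_of_pos sqrt3_pos]
      _ ≤ 3 * M' + 2 := by nlinarith [mul_le_mul_of_nonneg_right h3.le (abs_nonneg z.re)]
  abs_f₂_le z hz := by
    have hzn : ‖z‖ ≤ M' := (norm_le_level hz.1 hz.2.1).trans hz.2.2
    have h1 := abs_re_le_norm z; have h2 := abs_im_le_norm z
    have h3 : Real.sqrt 3 < 2 := by
      have := sqrt3_mul_self; nlinarith [sqrt3_pos]
    calc |Real.sqrt 3 * z.im + z.re| ≤ |Real.sqrt 3 * z.im| + |z.re| := abs_add_le _ _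
      _ = Real.sqrt 3 * |z.im| + |z.re| := by rw [abs_mul, abs_of_pos sqrt3_pos]
      _ ≤ 3 * M' + 2 := by nlinarith [mul_le_mul_of_nonneg_right h3.le (abs_nonneg z.im)]
  abs_f₁₁_le _ _ := by
    rw [abs_neg, abs_of_pos sqrt3_pos]
    have := sqrt3_mul_self; nlinarith [sqrt3_pos]
  abs_f₁₂_le _ _ := by rw [abs_one]; linarith
  abs_f₂₂_le _ _ := by
    rw [abs_of_pos sqrt3_pos]
    have := sqrt3_mul_self; nlinarith [sqrt3_pos]
  harmonic _ _ := by ring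
  bc₁ z hz := by
    have key : (-Real.sqrt 3 * z.re + z.im) / 2 + Real.sqrt 3 / 2 * (Real.sqrt 3 * z.im + z.re) = 2 * z.im := by
      linear_combination (z.im / 2) * sqrt3_mul_self
    rw [key, im_eq_quadY]
    rw [show 2 * (Real.sqrt 3 / 2 * quadY z) = Real.sqrt 3 * quadY z by ring, abs_of_nonneg (mul_nonneg sqrt3_pos.le hz.2.1)]
  bc₂ z hz := by
    have key : -Real.sqrt 3 * z.re + z.im = -(Real.sqrt 3 * quadX z) := by
      rw [re_eq_quad, im_eq_quadY]; ring
    rw [key, abs_neg, abs_of_nonneg (mul_nonneg sqrt3_pos.le hz.1)]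
  C₁_nonneg := by linarith
  C₂_nonneg := sqrt3_pos.le
  ω_nonneg _ := le_rfl
  ω_mono _ _ _ := le_rfl
  ω_le _ := le_rfl
  ω_tendsto := tendsto_const_nhds
  taylor z hz z' hz' := by
    rw [quadF_of_mem (levelRegion_mono hM' hz'), quadF_of_mem (levelRegion_mono hM' hz), quadPoly_eq, quadPoly_eq]
    simp only [sub_re, sub_im, zero_mul]
    have : -(Real.sqrt 3 / 2) * (z'.re ^ 2 - z'.im ^ 2) + z'.re * z'.im - (-(Real.sqrt 3 / 2) * (z.re ^ 2 - z.im ^ 2) + z.re * z.im)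
        - ((-Real.sqrt 3 * z.re + z.im) * (z'.re - z.re) + (Real.sqrt 3 * z.im + z.re) * (z'.im - z.im))
        - (-Real.sqrt 3 * (z'.re - z.re) ^ 2 + 2 * 1 * (z'.re - z.re) * (z'.im - z.im) + Real.sqrt 3 * (z'.im - z.im) ^ 2) / 2 = 0 := by
      ring
    rw [this, abs_zero]

/-- The test function of the quadratic data is `quadF`. [folklore] -/
@[simp] theorem quadData_F {N M' : ℝ} (hM'0 : 0 < M') (hM' : M' ≤ N) : (quadData hM'0 hM').F = quadF N := rfl

end Literature.Probability.RandomPlanarGeometry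


/-!
# The hitting position of the canonical `ORBM` on the opposite side is uniform

Layer of the proof of
`Literature.Probability.RandomPlanarGeometry.LawlerSchrammWerner2001_orbm_uniformHitting`
(`ObliqueRBMWedge.lean`), canonical model. For the canonical obliquely reflected Brownian motion
`canORBM` on the pair Wiener space (`ObliqueRBMWedgeCanonical`) and a level `N > 0`:

* `hitTime N`, `hitPos N` — the (a.s. finite) hitting time of the opposite side `{level = N}` and the
  hitting position; measurability; `hitPos N ∈ oppositeSide N` and no earlier visit, a.s.;
* `integral_hitPos_eq` — from the stopped Dynkin identity
  (`OrbmTestData.integral_stoppedProcess_canORBM_eq`, `ObliqueRBMWedgeDynkinSum`) by `t → ∞` and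
  `M ↑ N` (bounded convergence, continuity of the test function on the closed triangle):
  `E[F(Z_{T_N})] = F(0)` for the oblique harmonic test functions (`ObliqueRBMWedgeTestFun`) and the
  quadratic one (`ObliqueRBMWedgeQuadratic`);
* unpacking with the trace / apex identities (`ObliqueRBMWedgeApex`) and the identification theorem
  (`ObliqueRBMWedgeIdentify`): the side parameter `S = quadY(Z_{T_N})/N` is uniform on `[0,1]`, so
  `hasLaw_hitPos : HasLaw (hitPos N) (uniformOppositeSide N) wienerPair`.

## References

* J. Dubédat, *Reflected planar Brownian motions, intertwining relations and crossing
  probabilities*, Ann. IHP 40 (2004), §4 (uniform hitting distribution of `ORBM_{π/3}`);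
  G. Lawler, O. Schramm, W. Werner, *Values of Brownian intersection exponents I*, Acta Math. 187
  (2001). [Dubedat2004]
-/

noncomputable section

open Set Filter Topology Complex MeasureTheory ProbabilityTheory intervalIntegral
open scoped Real NNReal ENNReal
open Literature.Probability.Process

namespace Literature.Probability.RandomPlanarGeometry

open OrbmTestData (stopTime stoppedProcess_canORBM_eq canORBM_stopTime_mem)

/-! ### The hitting time and position -/

/-- The hitting time of the opposite side at level `N`, read in `ℝ≥0` (junk `0` on the null event
where the side is never reached). [folklore] -/
def hitTime (N : ℝ) (ω : WienerPair) : ℝ≥0 := (canHit N ω).untopD 0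

/-- **The hitting position** `Z_{T_N}`. [folklore] -/
def hitPos (N : ℝ) (ω : WienerPair) : ℂ := canORBM (hitTime N ω) ω

/-- Auxiliary statement (`hitTime_of_eq_coe`). [folklore] -/
theorem hitTime_of_eq_coe {N : ℝ} {ω : WienerPair} {T : ℝ≥0} (h : canHit N ω = T) : hitTime N ω = T := by
  rw [hitTime, h, WithTop.untopD_coe]

/-- Auxiliary statement (`canHit_eq_coe_hitTime`). [folklore] -/
theorem canHit_eq_coe_hitTime {N : ℝ} {ω : WienerPair} (h : canHit N ω ≠ ⊤) : canHit N ω = (hitTime N ω : WithTop ℝ≥0) := by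
  obtain ⟨T, hT⟩ := WithTop.ne_top_iff_exists.1 h
  rw [hitTime_of_eq_coe hT.symm, hT]

/-- At the finite hitting time the level is `N`. [folklore] -/
theorem canLevel_hitTime {N : ℝ} (hN : 0 < N) {ω : WienerPair} (h : canHit N ω ≠ ⊤) : canLevel (hitTime N ω) ω = N :=
  canLevel_canHit hN (canHit_eq_coe_hitTime h)

/-- The hitting position lies in the closed triangle `levelRegion N` (always). [folklore] -/
theorem hitPos_mem_levelRegion {N : ℝ} (hN : 0 < N) (ω : WienerPair) : hitPos N ω ∈ levelRegion N := by
  refine ⟨quadX_canORBM_nonneg _ ω, quadY_canORBM_nonneg _ ω, ?_⟩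
  show canLevel (hitTime N ω) ω ≤ N
  by_cases h : canHit N ω = ⊤
  · rw [hitTime, h, WithTop.untopD_top, canLevel_zero]; exact hN.le
  · exact (canLevel_hitTime hN h).le

/-- On the event of a finite hitting time, the hitting position lies on the opposite side:
`level = N`. [folklore] -/
theorem canLevel_hitPos {N : ℝ} (hN : 0 < N) {ω : WienerPair} (h : canHit N ω ≠ ⊤) :
    quadX (hitPos N ω) + quadY (hitPos N ω) = N := canLevel_hitTime hN h

/-- After the hitting time the stopped process is frozen at the hitting position. [folklore] -/
theorem stoppedProcess_eq_hitPos {N : ℝ} {ω : WienerPair} (h : canHit N ω ≠ ⊤) {t : ℝ≥0} (ht : hitTime N ω ≤ t) :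
    stoppedProcess canORBM (canHit N) t ω = hitPos N ω := by
  rw [stoppedProcess_canORBM_eq, stopTime, canHit_eq_coe_hitTime h, untopA_min_coe_coe, min_eq_right ht, hitPos]

/-- **Monotonicity of hitting times in the level.** [folklore] -/
theorem canHit_mono {M M' : ℝ} (hM' : 0 < M') (hMM' : M ≤ M') (ω : WienerPair) : canHit M ω ≤ canHit M' ω := by
  by_cases h : canHit M' ω = ⊤
  · rw [h]; exact le_top
  · rw [canHit_eq_coe_hitTime h]
    exact canHit_le_of_le_canLevel (hMM'.trans (canLevel_hitTime hM' h).ge)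

/-! ### Measurability -/

/-- `{canHit ≠ ⊤}` is measurable. [folklore] -/
theorem measurableSet_canHit_ne_top (N : ℝ) : MeasurableSet {ω | canHit N ω ≠ ⊤} := by
  have : {ω | canHit N ω ≠ ⊤} = ⋃ n : ℕ, {ω | ((n : ℝ≥0) : WithTop ℝ≥0) < canHit N ω}ᶜ := by
    ext ω
    simp only [mem_setOf_eq, mem_iUnion, mem_compl_iff, not_lt]
    constructor
    · intro h
      obtain ⟨T, hT⟩ := WithTop.ne_top_iff_exists.1 h
      obtain ⟨n, hn⟩ := exists_nat_ge T
      exact ⟨n, by rw [← hT]; exact_mod_cast hn⟩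
    · rintro ⟨n, hn⟩ htop
      rw [htop] at hn
      exact absurd hn (not_le.2 (WithTop.coe_lt_top _))
  rw [this]
  exact MeasurableSet.iUnion fun n ↦ (measurableSet_coe_lt_canHit _ N).compl

/-- **The hitting time is measurable.** [folklore] -/
theorem measurable_hitTime (N : ℝ) : Measurable (hitTime N) := by
  refine measurable_of_Ioi fun r ↦ ?_
  have : hitTime N ⁻¹' Ioi r = {ω | ((r : ℝ≥0) : WithTop ℝ≥0) < canHit N ω} ∩ {ω | canHit N ω ≠ ⊤} := by
    ext ω
    simp only [mem_preimage, mem_Ioi, mem_inter_iff, mem_setOf_eq]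
    constructor
    · intro h
      by_cases htop : canHit N ω = ⊤
      · rw [hitTime, htop, WithTop.untopD_top] at h; simp at h
      · refine ⟨?_, htop⟩
        rw [canHit_eq_coe_hitTime htop]; exact_mod_cast h
    · rintro ⟨h, htop⟩
      rw [canHit_eq_coe_hitTime htop] at h; exact_mod_cast h
  rw [this]
  exact (measurableSet_coe_lt_canHit r N).inter (measurableSet_canHit_ne_top N)

/-- The canonical process read at a random time is measurable (joint measurability of a
continuous-in-time, measurable-in-`ω` process). [folklore] -/
theorem measurable_canORBM_rand {σ : WienerPair → ℝ≥0} (hσ : Measurable σ) : Measurable fun ω ↦ canORBM (σ ω) ω :=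
  (measurable_uncurry_of_continuous_of_measurable (u := canORBM) continuous_canORBM measurable_canORBM).comp
    (hσ.prodMk measurable_id)

/-- Auxiliary statement (`measurable_hitPos`). [folklore] -/
theorem measurable_hitPos (N : ℝ) : Measurable (hitPos N) := measurable_canORBM_rand (measurable_hitTime N)

/-- The stopped clock in terms of the hitting time. [folklore] -/
theorem stopTime_eq (M : ℝ) (t : ℝ≥0) (ω : WienerPair) :
    stopTime M t ω = if canHit M ω = ⊤ then t else min t (hitTime M ω) := by
  rw [stopTime]
  by_cases h : canHit M ω = ⊤
  · rw [if_pos h, h, untopA_min_coe_top]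
  · rw [if_neg h, canHit_eq_coe_hitTime h, untopA_min_coe_coe]

/-- Auxiliary statement (`measurable_stopTime`). [folklore] -/
theorem measurable_stopTime (M : ℝ) (t : ℝ≥0) : Measurable (stopTime M t) := by
  have : stopTime M t = fun ω ↦ if canHit M ω = ⊤ then t else min t (hitTime M ω) := funext (stopTime_eq M t)
  rw [this]
  refine Measurable.ite ?_ measurable_const (measurable_const.min (measurable_hitTime M))
  have h := (measurableSet_canHit_ne_top M).compl
  have heq : {ω | canHit M ω ≠ ⊤}ᶜ = {ω | canHit M ω = ⊤} := by ext ω; simp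
  rwa [heq] at h

/-- **The stopped canonical process is measurable.** [folklore] -/
theorem measurable_stoppedProcess_canORBM (M : ℝ) (t : ℝ≥0) :
    Measurable fun ω ↦ stoppedProcess canORBM (canHit M) t ω := by
  have : (fun ω ↦ stoppedProcess canORBM (canHit M) t ω) = fun ω ↦ canORBM (stopTime M t ω) ω :=
    funext fun ω ↦ stoppedProcess_canORBM_eq M t ω
  rw [this]; exact measurable_canORBM_rand (measurable_stopTime M t)

/-! ### Passing to the limit `t → ∞` -/

/-- **From the stopped identity to the hitting position** (`t → ∞`, bounded convergence):
if `E[F(Z_{τ_M ∧ n})] = c` for all `n` then `E[F(Z_{τ_M})] = c`. [folklore] -/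
theorem integral_hitPos_of_stopped {M : ℝ} {F : ℂ → ℝ} (hF : Measurable F) {C : ℝ} (hFC : ∀ z, |F z| ≤ C) {c : ℝ}
    (h : ∀ n : ℕ, ∫ ω, F (stoppedProcess canORBM (canHit M) (n : ℝ≥0) ω) ∂wienerPair = c) :
    ∫ ω, F (hitPos M ω) ∂wienerPair = c := by
  have hlim : Tendsto (fun n : ℕ ↦ ∫ ω, F (stoppedProcess canORBM (canHit M) (n : ℝ≥0) ω) ∂wienerPair) atTop
      (𝓝 (∫ ω, F (hitPos M ω) ∂wienerPair)) := by
    refine tendsto_integral_of_dominated_convergence (fun _ ↦ C)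
      (fun n ↦ (hF.comp (measurable_stoppedProcess_canORBM M n)).aestronglyMeasurable) (integrable_const C)
      (fun n ↦ ae_of_all _ fun ω ↦ by rw [Real.norm_eq_abs]; exact hFC _) ?_
    filter_upwards [ae_canHit_ne_top M] with ω hω
    obtain ⟨n₀, hn₀⟩ := exists_nat_ge (hitTime M ω)
    refine tendsto_const_nhds.congr' ?_
    filter_upwards [eventually_ge_atTop n₀] with n hn
    rw [stoppedProcess_eq_hitPos hω (hn₀.trans (by exact_mod_cast hn))]
  have hconst : Tendsto (fun n : ℕ ↦ ∫ ω, F (stoppedProcess canORBM (canHit M) (n : ℝ≥0) ω) ∂wienerPair) atTop (𝓝 c) := by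
    simp_rw [h]; exact tendsto_const_nhds
  exact tendsto_nhds_unique hlim hconst

/-! ### Passing to the limit `M ↑ N` -/

/-- **Convergence of hitting times in the level**: if `M_k ↑ N` then `T_{M_k} → T_N` on the event
`{T_N < ∞}`. [folklore] -/
theorem tendsto_hitTime {N : ℝ} (hN : 0 < N) {Mseq : ℕ → ℝ} (hM0 : ∀ k, 0 < Mseq k) (hMN : ∀ k, Mseq k ≤ N)
    (hmono : Monotone Mseq) (hlim : Tendsto Mseq atTop (𝓝 N)) {ω : WienerPair} (hω : canHit N ω ≠ ⊤) :
    Tendsto (fun k ↦ hitTime (Mseq k) ω) atTop (𝓝 (hitTime N ω)) := by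
  -- the hitting times are finite, nondecreasing and bounded by `T_N`
  have hfin : ∀ k, canHit (Mseq k) ω ≠ ⊤ := fun k h ↦ by
    have := canHit_mono hN (hMN k) ω
    rw [h, top_le_iff] at this
    exact hω this
  have hle : ∀ k, hitTime (Mseq k) ω ≤ hitTime N ω := fun k ↦ by
    have := canHit_mono hN (hMN k) ω
    rw [canHit_eq_coe_hitTime (hfin k), canHit_eq_coe_hitTime hω] at this
    exact_mod_cast this
  have hmonoT : Monotone fun k ↦ hitTime (Mseq k) ω := fun i j hij ↦ by
    have := canHit_mono (hM0 j) (hmono hij) ω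
    rw [canHit_eq_coe_hitTime (hfin i), canHit_eq_coe_hitTime (hfin j)] at this
    exact_mod_cast this
  -- monotone bounded ⇒ converges to its supremum `T* ≤ T_N`
  have hbdd : BddAbove (range fun k ↦ hitTime (Mseq k) ω) := ⟨hitTime N ω, by rintro _ ⟨k, rfl⟩; exact hle k⟩
  have hconv := tendsto_atTop_ciSup hmonoT hbdd
  set Tstar := ⨆ k, hitTime (Mseq k) ω with hT
  have hTle : Tstar ≤ hitTime N ω := ciSup_le hle
  -- the level at `T*` is `N` by continuity, hence `T_N ≤ T*`
  have hlev : canLevel Tstar ω = N := by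
    have h1 : Tendsto (fun k ↦ canLevel (hitTime (Mseq k) ω) ω) atTop (𝓝 (canLevel Tstar ω)) :=
      ((continuous_canLevel ω).tendsto Tstar).comp hconv
    have h2 : Tendsto (fun k ↦ canLevel (hitTime (Mseq k) ω) ω) atTop (𝓝 N) := by
      have : (fun k ↦ canLevel (hitTime (Mseq k) ω) ω) = Mseq := funext fun k ↦ canLevel_hitTime (hM0 k) (hfin k)
      rw [this]; exact hlim
    exact tendsto_nhds_unique h1 h2
  have hge : hitTime N ω ≤ Tstar := by
    have := canHit_le_of_le_canLevel (N := N) (t := Tstar) (ω := ω) hlev.ge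
    rw [canHit_eq_coe_hitTime hω] at this
    exact_mod_cast this
  have heq : Tstar = hitTime N ω := le_antisymm hTle hge
  rwa [heq] at hconv

/-- **From the levels below to the level `N`** (continuity of the test function on the closed
triangle, bounded convergence). [folklore] -/
theorem integral_hitPos_of_below {N : ℝ} (hN : 0 < N) {F : ℂ → ℝ} (hF : Measurable F) {C : ℝ} (hFC : ∀ z, |F z| ≤ C)
    (hcont : ContinuousOn F (levelRegion N)) {c : ℝ}
    (h : ∀ M, 0 < M → M < N → ∫ ω, F (hitPos M ω) ∂wienerPair = c) :
    ∫ ω, F (hitPos N ω) ∂wienerPair = c := by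
  -- levels `M_k = N (1 - 1/(k+2))`
  set Mseq : ℕ → ℝ := fun k ↦ N * (1 - 1 / ((k : ℝ) + 2)) with hMseq
  have hM0 : ∀ k, 0 < Mseq k := fun k ↦ by
    rw [hMseq]; simp only
    have : (1 : ℝ) / ((k : ℝ) + 2) < 1 := by rw [div_lt_one (by positivity)]; linarith [(Nat.cast_nonneg k : (0:ℝ) ≤ k)]
    exact mul_pos hN (by linarith)
  have hMN : ∀ k, Mseq k < N := fun k ↦ by
    rw [hMseq]; simp only
    have : 0 < (1 : ℝ) / ((k : ℝ) + 2) := by positivity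
    nlinarith
  have hmono : Monotone Mseq := fun i j hij ↦ by
    rw [hMseq]; simp only
    apply mul_le_mul_of_nonneg_left _ hN.le
    have : (1 : ℝ) / ((j : ℝ) + 2) ≤ 1 / ((i : ℝ) + 2) :=
      one_div_le_one_div_of_le (by positivity) (by exact_mod_cast Nat.add_le_add_right hij 2)
    linarith
  have hlim : Tendsto Mseq atTop (𝓝 N) := by
    have h1 : Tendsto (fun k : ℕ ↦ (1 : ℝ) / ((k : ℝ) + 2)) atTop (𝓝 0) := by
      have := tendsto_one_div_add_atTop_nhds_zero_nat (𝕜 := ℝ)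
      have h2 : Tendsto (fun k : ℕ ↦ (1 : ℝ) / (((k + 1 : ℕ) : ℝ) + 1)) atTop (𝓝 0) := this.comp (tendsto_add_atTop_nat 1)
      refine h2.congr fun k ↦ ?_
      push_cast; ring_nf
    have : Tendsto (fun k : ℕ ↦ N * (1 - 1 / ((k : ℝ) + 2))) atTop (𝓝 (N * (1 - 0))) :=
      (tendsto_const_nhds.sub h1).const_mul N
    rw [sub_zero, mul_one] at this
    exact this
  have hlimF : Tendsto (fun k ↦ ∫ ω, F (hitPos (Mseq k) ω) ∂wienerPair) atTop (𝓝 (∫ ω, F (hitPos N ω) ∂wienerPair)) := by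
    refine tendsto_integral_of_dominated_convergence (fun _ ↦ C)
      (fun k ↦ (hF.comp (measurable_hitPos _)).aestronglyMeasurable) (integrable_const C)
      (fun k ↦ ae_of_all _ fun ω ↦ by rw [Real.norm_eq_abs]; exact hFC _) ?_
    filter_upwards [ae_canHit_ne_top N] with ω hω
    have hT := tendsto_hitTime hN hM0 (fun k ↦ (hMN k).le) hmono hlim hω
    have hpos : Tendsto (fun k ↦ hitPos (Mseq k) ω) atTop (𝓝 (hitPos N ω)) :=
      ((continuous_canORBM ω).tendsto _).comp hT
    have hwithin : Tendsto (fun k ↦ hitPos (Mseq k) ω) atTop (𝓝[levelRegion N] (hitPos N ω)) :=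
      tendsto_nhdsWithin_iff.2 ⟨hpos, Eventually.of_forall fun k ↦
        levelRegion_mono (hMN k).le (hitPos_mem_levelRegion (hM0 k) ω)⟩
    exact (hcont _ (hitPos_mem_levelRegion hN ω)).tendsto.comp hwithin
  have hconst : Tendsto (fun k ↦ ∫ ω, F (hitPos (Mseq k) ω) ∂wienerPair) atTop (𝓝 c) := by
    have : (fun k ↦ ∫ ω, F (hitPos (Mseq k) ω) ∂wienerPair) = fun _ ↦ c := funext fun k ↦ h _ (hM0 k) (hMN k)
    rw [this]; exact tendsto_const_nhds
  exact tendsto_nhds_unique hlimF hconst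

/-- **The Dynkin identity at the hitting position** for a test datum available at every level below
`N`: `E[F(Z_{T_N})] = F(0)`. [folklore] -/
theorem integral_hitPos_eq {N : ℝ} (hN : 0 < N) {F : ℂ → ℝ} (hF : Measurable F) {C : ℝ} (hFC : ∀ z, |F z| ≤ C)
    (hcont : ContinuousOn F (levelRegion N))
    (hD : ∀ M', 0 < M' → M' < N → ∃ D : OrbmTestData M', D.F = F) :
    ∫ ω, F (hitPos N ω) ∂wienerPair = F 0 := by
  refine integral_hitPos_of_below hN hF hFC hcont fun M hM hMN ↦ ?_
  -- use the test datum at level `M' = (M + N)/2`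
  set M' : ℝ := (M + N) / 2 with hM'
  obtain ⟨D, hDF⟩ := hD M' (by rw [hM']; linarith) (by rw [hM']; linarith)
  refine integral_hitPos_of_stopped hF hFC fun n ↦ ?_
  have ha : 0 < (M' - M) / 8 := by rw [hM']; linarith
  have := D.integral_stoppedProcess_canORBM_eq (a := (M' - M) / 8) hM (by linarith) ha (n : ℝ≥0)
  rwa [hDF] at this

/-! ### The identities for the two families of test functions -/

/-- **`E[F_D(Z_{T_N})] = Re Φ_D(∞)`** for the oblique harmonic test functions. [folklore] -/
theorem integral_testF_hitPos (D : TestIntervals) {N : ℝ} (hN : 0 < N) :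
    ∫ ω, D.testF N (hitPos N ω) ∂wienerPair = (D.phiInf).re := by
  have h := integral_hitPos_eq hN (D.measurable_testF hN) (D.abs_testF_le hN) (D.continuousOn_testF hN)
    (fun M' hM'0 hM' ↦ ⟨D.testData hN hM'0 hM', rfl⟩)
  rw [h, D.testF_zero hN.le]

/-- **`E[F₂(Z_{T_N})] = 0`** for the quadratic test function. [folklore] -/
theorem integral_quadF_hitPos {N : ℝ} (hN : 0 < N) : ∫ ω, quadF N (hitPos N ω) ∂wienerPair = 0 := by
  have h := integral_hitPos_eq hN (measurable_quadF N) (abs_quadF_le N) (continuousOn_quadF N)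
    (fun M' hM'0 hM' ↦ ⟨quadData hM'0 hM'.le, rfl⟩)
  rw [h, quadF_zero hN.le]

/-! ### The side parameter of the hitting position -/

/-- **The side parameter** `S = quadY(Z_{T_N})/N ∈ [0, 1]` (clamped; the clamp is inactive a.s.).
[folklore] -/
def sideParam (N : ℝ) (ω : WienerPair) : ℝ := max 0 (min 1 (quadY (hitPos N ω) / N))

/-- Auxiliary statement (`measurable_sideParam`). [folklore] -/
theorem measurable_sideParam (N : ℝ) : Measurable (sideParam N) := by
  unfold sideParam
  exact measurable_const.max (measurable_const.min ((measurable_quadY.comp (measurable_hitPos N)).div_const N))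

/-- Auxiliary statement (`sideParam_mem`). [folklore] -/
theorem sideParam_mem (N : ℝ) (ω : WienerPair) : sideParam N ω ∈ Icc (0:ℝ) 1 :=
  ⟨le_max_left _ _, max_le zero_le_one (min_le_left _ _)⟩

/-- On the event of a finite hitting time the clamp is inactive. [folklore] -/
theorem sideParam_eq {N : ℝ} (hN : 0 < N) {ω : WienerPair} (hω : canHit N ω ≠ ⊤) :
    sideParam N ω = quadY (hitPos N ω) / N := by
  have hy : 0 ≤ quadY (hitPos N ω) := quadY_canORBM_nonneg _ ω
  have hx : 0 ≤ quadX (hitPos N ω) := quadX_canORBM_nonneg _ ω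
  have hl := canLevel_hitPos hN hω
  have h1 : quadY (hitPos N ω) / N ≤ 1 := by rw [div_le_one hN]; linarith
  have h0 : 0 ≤ quadY (hitPos N ω) / N := div_nonneg hy hN.le
  rw [sideParam, min_eq_right h1, max_eq_right h0]

/-- **The hitting position is the side point of parameter `S`** (on `{T_N < ∞}`). [folklore] -/
theorem hitPos_eq_oppositeSideParam {N : ℝ} (hN : 0 < N) {ω : WienerPair} (hω : canHit N ω ≠ ⊤) :
    hitPos N ω = oppositeSideParam N (sideParam N ω) := by
  have hl := canLevel_hitPos hN hω
  have h := oppositeSideParam_quad (hitPos N ω) (by rw [hl]; exact hN.ne')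
  rw [hl] at h
  rw [sideParam_eq hN hω, h]

/-- Auxiliary statement (`ae_hitPos_eq`). [folklore] -/
theorem ae_hitPos_eq {N : ℝ} (hN : 0 < N) :
    ∀ᵐ ω ∂wienerPair, hitPos N ω = oppositeSideParam N (sideParam N ω) := by
  filter_upwards [ae_canHit_ne_top N] with ω hω
  exact hitPos_eq_oppositeSideParam hN hω

/-- The trace integral as a function of `ω` (through the side parameter). [folklore] -/
theorem testF_oppositeSideParam_sideParam (D : TestIntervals) {N : ℝ} (hN : 0 < N) (ω : WienerPair) :
    D.testF N (oppositeSideParam N (sideParam N ω)) = (D.phiExt D.rz).re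
      + ∫ y in (0:ℝ)..1, (Iio (scRatioInv (sideParam N ω))).indicator (fun y ↦ π * TestIntervals.rhoTilde y * D.m y) y := by
  rw [D.testF_oppositeSideParam hN (sideParam_mem N ω), D.re_phiExt_eq_indicator (scRatioInv_mem (sideParam_mem N ω))]

/-- **The first family of identities** in the form of the identification theorem. [folklore] -/
theorem trace_identity (D : TestIntervals) {N : ℝ} (hN : 0 < N) :
    ∫ y in (0:ℝ)..1, π * TestIntervals.rhoTilde y * D.m y * survY wienerPair (sideParam N) y
      = ∫ y in (0:ℝ)..1, π * TestIntervals.rhoTilde y * D.m y * (1 - scRatio y) := by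
  set f : ℝ → ℝ := fun y ↦ π * TestIntervals.rhoTilde y * D.m y with hf
  obtain ⟨C, hC0, hC⟩ := D.exists_bound_traceDensity
  -- `E[F_D(Z_T)] = Re Φₑ(rz) + ∫₀¹ f survY`
  have hmeasG : Measurable fun ω ↦ D.testF N (oppositeSideParam N (sideParam N ω)) :=
    (D.measurable_testF hN).comp ((continuous_oppositeSideParam N).measurable.comp (measurable_sideParam N))
  have hI : ∀ ω, (∫ y in (0:ℝ)..1, (Iio (scRatioInv (sideParam N ω))).indicator f y)
      = D.testF N (oppositeSideParam N (sideParam N ω)) - (D.phiExt D.rz).re := fun ω ↦ by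
    rw [testF_oppositeSideParam_sideParam D hN ω]; ring
  have hmeasI : Measurable fun ω ↦ ∫ y in (0:ℝ)..1, (Iio (scRatioInv (sideParam N ω))).indicator f y := by
    have : (fun ω ↦ ∫ y in (0:ℝ)..1, (Iio (scRatioInv (sideParam N ω))).indicator f y)
        = fun ω ↦ D.testF N (oppositeSideParam N (sideParam N ω)) - (D.phiExt D.rz).re := funext hI
    rw [this]; exact hmeasG.sub measurable_const
  have hintI : Integrable (fun ω ↦ ∫ y in (0:ℝ)..1, (Iio (scRatioInv (sideParam N ω))).indicator f y) wienerPair := by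
    refine Integrable.of_bound hmeasI.aestronglyMeasurable C (ae_of_all _ fun ω ↦ ?_)
    rw [Real.norm_eq_abs]
    have := intervalIntegral.norm_integral_le_of_norm_le_const (a := (0:ℝ)) (b := 1) (C := C)
      (f := fun y ↦ (Iio (scRatioInv (sideParam N ω))).indicator f y) fun y _ ↦ by
        rw [Real.norm_eq_abs]
        by_cases hy : y ∈ Iio (scRatioInv (sideParam N ω))
        · rw [indicator_of_mem hy]; exact hC y
        · rw [indicator_of_notMem hy, abs_zero]; exact hC0
    simpa using this
  have h1 : ∫ ω, D.testF N (hitPos N ω) ∂wienerPair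
      = (D.phiExt D.rz).re + ∫ y in (0:ℝ)..1, f y * survY wienerPair (sideParam N) y := by
    rw [← integral_integral_indicator_eq (P := wienerPair) (measurable_sideParam N) (sideParam_mem N)
      D.measurable_traceDensity hC]
    have hae : (fun ω ↦ D.testF N (hitPos N ω)) =ᵐ[wienerPair] fun ω ↦ D.testF N (oppositeSideParam N (sideParam N ω)) :=
      (ae_hitPos_eq hN).mono fun ω hω ↦ by simp only; rw [hω]
    rw [integral_congr_ae hae]
    simp_rw [testF_oppositeSideParam_sideParam D hN]
    rw [integral_add (integrable_const _) hintI, MeasureTheory.integral_const, smul_eq_mul, probReal_univ, one_mul]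
  rw [integral_testF_hitPos D hN] at h1
  have h2 := D.re_phiInf_sub_re_phiExt_rz
  rw [hf] at h1
  simp only at h1
  linarith

/-- **The mean of the side parameter is `1/2`** (from the quadratic test function). [folklore] -/
theorem integral_sideParam {N : ℝ} (hN : 0 < N) : ∫ ω, sideParam N ω ∂wienerPair = 1 / 2 := by
  have h := integral_quadF_hitPos hN
  have hae : (fun ω ↦ quadF N (hitPos N ω)) =ᵐ[wienerPair] fun ω ↦ quadF N (oppositeSideParam N (sideParam N ω)) :=
    (ae_hitPos_eq hN).mono fun ω hω ↦ by simp only; rw [hω]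
  rw [integral_congr_ae hae] at h
  simp_rw [quadF_oppositeSideParam hN (sideParam_mem N _)] at h
  have hint : Integrable (sideParam N) wienerPair :=
    Integrable.of_bound (measurable_sideParam N).aestronglyMeasurable 1 (ae_of_all _ fun ω ↦ by
      rw [Real.norm_eq_abs, abs_of_nonneg (sideParam_mem N ω).1]; exact (sideParam_mem N ω).2)
  have hcalc : ∫ ω, N ^ 2 * (Real.sqrt 3 * (sideParam N ω - 1 / 2)) ∂wienerPair
      = N ^ 2 * Real.sqrt 3 * (∫ ω, sideParam N ω ∂wienerPair - 1 / 2) := by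
    have : (fun ω ↦ N ^ 2 * (Real.sqrt 3 * (sideParam N ω - 1 / 2))) = fun ω ↦ N ^ 2 * Real.sqrt 3 * (sideParam N ω - 1 / 2) := by
      funext ω; ring
    rw [this, MeasureTheory.integral_const_mul, integral_sub hint (integrable_const _), MeasureTheory.integral_const,
      smul_eq_mul, probReal_univ, one_mul]
  rw [hcalc] at h
  have hne : N ^ 2 * Real.sqrt 3 ≠ 0 := mul_ne_zero (pow_ne_zero _ hN.ne') sqrt3_pos.ne'
  have := (mul_eq_zero.1 h).resolve_left hne
  linarith

/-! ### The law of the hitting position -/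

/-- **The side parameter is uniform on `[0, 1]`.** [folklore] -/
theorem map_sideParam {N : ℝ} (hN : 0 < N) : wienerPair.map (sideParam N) = volume.restrict (Icc (0:ℝ) 1) :=
  map_eq_uniform_of_test_identities (measurable_sideParam N) (sideParam_mem N) (fun D ↦ trace_identity D hN)
    (integral_sideParam hN)

/-- **The hitting position of the canonical `ORBM` on the opposite side is uniform.** [folklore] -/
theorem hasLaw_hitPos {N : ℝ} (hN : 0 < N) : HasLaw (hitPos N) (uniformOppositeSide N) wienerPair := by
  refine ⟨(measurable_hitPos N).aemeasurable, ?_⟩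
  rw [Measure.map_congr (ae_hitPos_eq hN), uniformOppositeSide, ← map_sideParam hN,
    Measure.map_map (continuous_oppositeSideParam N).measurable (measurable_sideParam N)]
  rfl

/-- **The hitting event**: a.s. the hitting position lies on the opposite side and no earlier time
does. [folklore] -/
theorem ae_hitPos_mem_and_first {N : ℝ} (hN : 0 < N) :
    ∀ᵐ ω ∂wienerPair, hitPos N ω ∈ oppositeSide N ∧ ∀ t < hitTime N ω, canORBM t ω ∉ oppositeSide N := by
  filter_upwards [ae_canHit_ne_top N] with ω hω
  refine ⟨(mem_oppositeSide_iff hN (canORBM_mem_closedWedge _ ω)).2 (canLevel_hitPos hN hω), fun t ht hmem ↦ ?_⟩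
  have hlt : (t : WithTop ℝ≥0) < canHit N ω := by
    rw [canHit_eq_coe_hitTime hω]; exact_mod_cast ht
  have h1 := canLevel_lt_of_coe_lt_canHit hlt
  have h2 := (mem_oppositeSide_iff hN (canORBM_mem_closedWedge t ω)).1 hmem
  rw [canLevel] at h1
  linarith

end Literature.Probability.RandomPlanarGeometry


/-!
# Proof of `LawlerSchrammWerner2001_orbm_uniformHitting`

The named fact `Literature.Probability.RandomPlanarGeometry.LawlerSchrammWerner2001_orbm_uniformHitting`
(`ObliqueRBMWedge.lean`; Lawler–Schramm–Werner 2001, Dubédat 2004 §4): for every obliquely reflected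
Brownian motion `ORBM_{π/3}` in the wedge started at the vertex, the hitting position of the opposite
side at level `N` is uniform. The canonical model was settled in `ObliqueRBMWedgeHitting`
(`hasLaw_hitPos`); here we TRANSFER it to an arbitrary solution `(Ω, P, B, Z, ℓ₁, ℓ₂)` of the
Skorokhod problem `IsORBMSixty`:

* every solution is a.s. the explicit Skorokhod image of its driving Brownian path
  (`IsWedgeRBM.ae_eq_skorokhodMap`, `ObliqueRBMWedgeSkorokhod`), and the law of the pair of driving
  raw paths is `wienerPair` (independence of real and imaginary parts + uniqueness of the pre-Wiener
  law, `IsPreBrownianReal.map_path_eq`), which is also the law of the pair of continuous canonical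
  paths `pairPath` (`map_pairPath_wienerPair`);
* the hitting position is the pointwise limit of measurable functionals `approxPos N n` of the raw
  pair path that only read a dyadic skeleton (first dyadic grid time at which the dyadic running
  maximum of the level reaches `N`), for every path whose Skorokhod image is continuous and reaches
  the level — on both probability spaces;
* bounded convergence and the equality of the laws of the skeleton functionals identify the laws
  of the two hitting positions (`ext_of_forall_integral_eq_of_IsFiniteMeasure`).

## References

* G. F. Lawler, O. Schramm, W. Werner, *Values of Brownian intersection exponents I: Half-plane
  exponents*, Acta Math. 187 (2001), §3; J. Dubédat, *Reflected planar Brownian motions,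
  intertwining relations and crossing probabilities*, Ann. IHP 40 (2004), §4;
  W. Werner, LNM 1840 (2004), Ch. 5 Lemma 5.3. [Dubedat2004]
-/

noncomputable section

open Set Filter Topology Complex MeasureTheory ProbabilityTheory BoundedContinuousFunction
open scoped Real NNReal ENNReal
open Literature.Probability.Process

namespace Literature.Probability.RandomPlanarGeometry

/-! ### Raw path functionals (dyadic skeleton) -/

/-- The complex path of a pair of raw real paths. [folklore] -/
def zPath (q : WienerPair) (t : ℝ≥0) : ℂ := ((q.1 t : ℝ) : ℂ) + ((q.2 t : ℝ) : ℂ) * I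

/-- Auxiliary statement (`measurable_zPath`). [folklore] -/
theorem measurable_zPath (t : ℝ≥0) : Measurable fun q : WienerPair ↦ zPath q t := by
  unfold zPath
  refine Measurable.add ?_ ?_
  · exact Complex.measurable_ofReal.comp ((measurable_pi_apply t).comp measurable_fst)
  · exact (Complex.measurable_ofReal.comp ((measurable_pi_apply t).comp measurable_snd)).mul_const I

/-- The (dyadic) Skorokhod image `Γ_D(q)` of a pair of raw paths: the canonical `ORBM` formula
with the dyadic boundary terms. [folklore] -/
def rawORBM (q : WienerPair) (t : ℝ≥0) : ℂ :=
  zPath q t + dirSixty * ((skorokhodBdryDyad (fun s ↦ quadY (zPath q s)) t : ℝ) : ℂ)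
    + ((skorokhodBdryDyad (fun s ↦ quadX (zPath q s)) t : ℝ) : ℂ)

/-- Auxiliary statement (`measurable_rawORBM`). [folklore] -/
theorem measurable_rawORBM (t : ℝ≥0) : Measurable fun q : WienerPair ↦ rawORBM q t := by
  unfold rawORBM
  refine (Measurable.add ((measurable_zPath t).add ?_) ?_)
  · exact (Complex.measurable_ofReal.comp (measurable_skorokhodBdryDyad (X := fun s q ↦ quadY (zPath q s))
      (fun s ↦ measurable_quadY.comp (measurable_zPath s)) t)).const_mul _
  · exact Complex.measurable_ofReal.comp (measurable_skorokhodBdryDyad (X := fun s q ↦ quadX (zPath q s))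
      (fun s ↦ measurable_quadX.comp (measurable_zPath s)) t)

/-- The level of the dyadic Skorokhod image. [folklore] -/
def rawLevel (q : WienerPair) (t : ℝ≥0) : ℝ := quadX (rawORBM q t) + quadY (rawORBM q t)

/-- Auxiliary statement (`measurable_rawLevel`). [folklore] -/
theorem measurable_rawLevel (t : ℝ≥0) : Measurable fun q : WienerPair ↦ rawLevel q t :=
  (measurable_quadX.comp (measurable_rawORBM t)).add (measurable_quadY.comp (measurable_rawORBM t))

/-- The (continuous-time) Skorokhod image of a complex path. [folklore] -/
def skMap (β : ℝ≥0 → ℂ) (t : ℝ≥0) : ℂ :=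
  β t + dirSixty * ((skorokhodBdry (fun s ↦ quadY (β s)) t : ℝ) : ℂ) + ((skorokhodBdry (fun s ↦ quadX (β s)) t : ℝ) : ℂ)

/-- For continuous coordinates the dyadic and the continuous-time Skorokhod images agree.
[folklore] -/
theorem rawORBM_eq_skMap {q : WienerPair} (h1 : Continuous q.1) (h2 : Continuous q.2) (t : ℝ≥0) :
    rawORBM q t = skMap (zPath q) t := by
  have hz : Continuous (zPath q) := by unfold zPath; fun_prop
  have hY : Continuous fun s ↦ quadY (zPath q s) := continuous_quadY.comp hz
  have hX : Continuous fun s ↦ quadX (zPath q s) := continuous_quadX.comp hz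
  rw [rawORBM, skMap, skorokhodBdryDyad_eq hY, skorokhodBdryDyad_eq hX]

/-- **The canonical `ORBM` is the dyadic Skorokhod image of the pair of continuous canonical
paths.** [folklore] -/
theorem canORBM_eq_rawORBM (t : ℝ≥0) (ω : WienerPair) : canORBM t ω = rawORBM (pairPath ω) t := by
  have hz : ∀ s, zPath (pairPath ω) s = pairBM s ω := fun s ↦ rfl
  rw [rawORBM_eq_skMap (continuous_brownian ω.1) (continuous_brownian ω.2), skMap]
  simp only [hz]
  rfl

/-! ### The discrete hitting functionals -/

/-- The dyadic running maximum of the level on `[0, d]`. [folklore] -/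
def runLevel (d : ℝ≥0) (q : WienerPair) : ℝ := pathRunMax d (rawLevel q)

/-- Auxiliary statement (`measurable_runLevel`). [folklore] -/
theorem measurable_runLevel (d : ℝ≥0) : Measurable (runLevel d) := by
  unfold runLevel pathRunMax
  exact Measurable.iSup fun p ↦ measurable_rawLevel _

/-- The event "by the grid time `k/2ⁿ` the dyadic running level has reached `N`". [folklore] -/
def reachSet (N : ℝ) (n k : ℕ) : Set WienerPair := {q | N ≤ runLevel ((k : ℝ≥0) / 2 ^ n) q}

/-- Auxiliary statement (`measurableSet_reachSet`). [folklore] -/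
theorem measurableSet_reachSet (N : ℝ) (n k : ℕ) : MeasurableSet (reachSet N n k) :=
  measurableSet_le measurable_const (measurable_runLevel _)

/-- The event "`k/2ⁿ` is the FIRST grid time at which the level has been reached". [folklore] -/
def firstSet (N : ℝ) (n k : ℕ) : Set WienerPair := reachSet N n k ∩ ⋂ j ∈ Finset.range k, (reachSet N n j)ᶜ

/-- Auxiliary statement (`measurableSet_firstSet`). [folklore] -/
theorem measurableSet_firstSet (N : ℝ) (n k : ℕ) : MeasurableSet (firstSet N n k) :=
  (measurableSet_reachSet N n k).inter (MeasurableSet.biInter (Finset.range k).countable_toSet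
    fun j _ ↦ (measurableSet_reachSet N n j).compl)

/-- The sets `firstSet N n k`, `k ∈ ℕ`, are pairwise disjoint. [folklore] -/
theorem firstSet_disjoint {N : ℝ} {n k k' : ℕ} {q : WienerPair} (hk : q ∈ firstSet N n k) (hk' : q ∈ firstSet N n k') :
    k = k' := by
  by_contra hne
  rcases lt_or_gt_of_ne hne with h | h
  · exact (mem_iInter₂.1 hk'.2 k (Finset.mem_range.2 h)) hk.1
  · exact (mem_iInter₂.1 hk.2 k' (Finset.mem_range.2 h)) hk'.1

/-- **The `n`-th approximate hitting position**: the dyadic Skorokhod image at the first grid time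
`k/2ⁿ ≤ n` at which the dyadic running level has reached `N` (`0` if there is none). [folklore] -/
def approxPos (N : ℝ) (n : ℕ) (q : WienerPair) : ℂ :=
  ∑ k ∈ Finset.range (n * 2 ^ n + 1), (firstSet N n k).indicator (fun q ↦ rawORBM q ((k : ℝ≥0) / 2 ^ n)) q

/-- Auxiliary statement (`measurable_approxPos`). [folklore] -/
theorem measurable_approxPos (N : ℝ) (n : ℕ) : Measurable (approxPos N n) := by
  unfold approxPos
  refine Finset.measurable_sum _ fun k _ ↦ ?_
  exact (measurable_rawORBM _).indicator (measurableSet_firstSet N n k)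

/-- The value of `approxPos` on `firstSet N n k₀`, `k₀ ≤ n 2ⁿ`. [folklore] -/
theorem approxPos_of_mem {N : ℝ} {n k₀ : ℕ} (hk₀ : k₀ ≤ n * 2 ^ n) {q : WienerPair} (hq : q ∈ firstSet N n k₀) :
    approxPos N n q = rawORBM q ((k₀ : ℝ≥0) / 2 ^ n) := by
  unfold approxPos
  rw [Finset.sum_eq_single k₀]
  · rw [indicator_of_mem hq]
  · intro k _ hk
    rw [indicator_of_notMem]
    exact fun h ↦ hk (firstSet_disjoint h hq)
  · intro h
    exact absurd (Finset.mem_range.2 (Nat.lt_succ_of_le hk₀)) h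

/-! ### Convergence of the approximate hitting positions along good paths -/

/-- **Deterministic convergence**: if the dyadic Skorokhod image of `q` is a continuous path `Zc`
whose level first reaches `N` at time `T`, then `approxPos N n q → Zc T`. [folklore] -/
theorem tendsto_approxPos {N : ℝ} {q : WienerPair} {Zc : ℝ≥0 → ℂ} (hZc : Continuous Zc)
    (hZ : ∀ t, rawORBM q t = Zc t) {T : ℝ≥0} (hT : quadX (Zc T) + quadY (Zc T) = N)
    (hbefore : ∀ t < T, quadX (Zc t) + quadY (Zc t) < N) :
    Tendsto (fun n ↦ approxPos N n q) atTop (𝓝 (Zc T)) := by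
  -- the level path and its dyadic running maximum
  set ℓ : ℝ≥0 → ℝ := fun t ↦ quadX (Zc t) + quadY (Zc t) with hℓ
  have hℓc : Continuous ℓ := (continuous_quadX.comp hZc).add (continuous_quadY.comp hZc)
  have hlev : rawLevel q = ℓ := funext fun t ↦ by simp only [rawLevel, hZ, hℓ]
  have hreach : ∀ d : ℝ≥0, N ≤ runLevel d q ↔ T ≤ d := by
    intro d
    rw [runLevel, hlev, ← not_lt, pathRunMax_lt_iff hℓc, not_forall]
    constructor
    · rintro ⟨r, hr⟩
      rw [Classical.not_imp, not_lt] at hr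
      by_contra hd
      rw [not_le] at hd
      exact absurd (hbefore r (lt_of_le_of_lt hr.1 hd)) (not_lt.2 hr.2)
    · intro hd
      exact ⟨T, by rw [Classical.not_imp, not_lt]; exact ⟨hd, hT.ge⟩⟩
  -- the first grid index `k_n = ⌈T 2ⁿ⌉`
  set kseq : ℕ → ℕ := fun n ↦ ⌈(T : ℝ) * 2 ^ n⌉₊ with hk
  have hk_ge : ∀ n, (T : ℝ) ≤ (kseq n : ℝ) / 2 ^ n := fun n ↦ by
    rw [le_div_iff₀ (by positivity)]; exact Nat.le_ceil _
  have hk_lt : ∀ n, (kseq n : ℝ) / 2 ^ n < T + 1 / 2 ^ n := fun n ↦ by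
    rw [div_lt_iff₀ (by positivity), add_mul, one_div, inv_mul_cancel₀ (by positivity)]
    exact Nat.ceil_lt_add_one (by positivity)
  have hgrid : ∀ n, (((kseq n : ℝ≥0) / 2 ^ n : ℝ≥0) : ℝ) = (kseq n : ℝ) / 2 ^ n := fun n ↦ by push_cast; ring
  have hmem : ∀ n, q ∈ firstSet N n (kseq n) := by
    intro n
    refine ⟨(hreach _).2 ?_, mem_iInter₂.2 fun j hj ↦ ?_⟩
    · show T ≤ (kseq n : ℝ≥0) / 2 ^ n
      rw [← NNReal.coe_le_coe, hgrid]; exact hk_ge n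
    · show ¬ (N ≤ runLevel ((j : ℝ≥0) / 2 ^ n) q)
      rw [hreach, ← NNReal.coe_le_coe]
      push_cast
      rw [le_div_iff₀ (by positivity)]
      have hj' : (j : ℝ) + 1 ≤ kseq n := by exact_mod_cast Finset.mem_range.1 hj
      intro h
      have hceil : (kseq n : ℝ) < (T : ℝ) * 2 ^ n + 1 := Nat.ceil_lt_add_one (show 0 ≤ (T : ℝ) * 2 ^ n by positivity)
      linarith
  -- eventually `k_n ≤ n 2ⁿ`
  have hev : ∀ᶠ n in atTop, kseq n ≤ n * 2 ^ n := by
    obtain ⟨n₀, hn₀⟩ := exists_nat_gt ((T : ℝ) + 1)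
    filter_upwards [eventually_ge_atTop n₀] with n hn
    have h1 : (kseq n : ℝ) < ((T : ℝ) + 1) * 2 ^ n := by
      have hceil : (kseq n : ℝ) < (T : ℝ) * 2 ^ n + 1 := Nat.ceil_lt_add_one (show 0 ≤ (T : ℝ) * 2 ^ n by positivity)
      have h2 : (1 : ℝ) ≤ 2 ^ n := one_le_pow₀ (by norm_num)
      nlinarith
    have h3 : ((T : ℝ) + 1) * 2 ^ n ≤ (n : ℝ) * 2 ^ n := by
      apply mul_le_mul_of_nonneg_right _ (by positivity)
      linarith [(show (n₀ : ℝ) ≤ n by exact_mod_cast hn)]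
    exact_mod_cast (h1.trans_le h3).le
  -- the grid times converge to `T`
  have hgridT : Tendsto (fun n ↦ ((kseq n : ℝ≥0) / 2 ^ n : ℝ≥0)) atTop (𝓝 T) := by
    rw [← NNReal.tendsto_coe]
    simp_rw [hgrid]
    have h0 : Tendsto (fun n : ℕ ↦ (T : ℝ) + 1 / 2 ^ n) atTop (𝓝 ((T : ℝ) + 0)) := by
      refine tendsto_const_nhds.add ?_
      simp_rw [one_div]
      exact tendsto_inv_atTop_zero.comp (tendsto_pow_atTop_atTop_of_one_lt one_lt_two)
    rw [add_zero] at h0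
    exact tendsto_of_tendsto_of_tendsto_of_le_of_le tendsto_const_nhds h0 hk_ge fun n ↦ (hk_lt n).le
  have hlim : Tendsto (fun n ↦ Zc ((kseq n : ℝ≥0) / 2 ^ n)) atTop (𝓝 (Zc T)) := (hZc.tendsto T).comp hgridT
  refine hlim.congr' ?_
  filter_upwards [hev] with n hn
  rw [approxPos_of_mem hn (hmem n), hZ]

/-- **Reaching the level in terms of the skeleton**: under the same data (no finite hitting time
assumed), the level reaches `N` iff the skeleton event `⋃ₙ ⋃_{k ≤ n2ⁿ} reachSet N n k` holds.
[folklore] -/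
def reachEvent (N : ℝ) : Set WienerPair := ⋃ n : ℕ, ⋃ k ∈ Finset.range (n * 2 ^ n + 1), reachSet N n k

/-- Auxiliary statement (`measurableSet_reachEvent`). [folklore] -/
theorem measurableSet_reachEvent (N : ℝ) : MeasurableSet (reachEvent N) :=
  MeasurableSet.iUnion fun n ↦ MeasurableSet.biUnion (Finset.range _).countable_toSet fun k _ ↦ measurableSet_reachSet N n k

/-- Auxiliary statement (`mem_reachEvent_iff`). [folklore] -/
theorem mem_reachEvent_iff {N : ℝ} {q : WienerPair} {Zc : ℝ≥0 → ℂ} (hZc : Continuous Zc) (hZ : ∀ t, rawORBM q t = Zc t) :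
    q ∈ reachEvent N ↔ ∃ t : ℝ≥0, N ≤ quadX (Zc t) + quadY (Zc t) := by
  set ℓ : ℝ≥0 → ℝ := fun t ↦ quadX (Zc t) + quadY (Zc t) with hℓ
  have hℓc : Continuous ℓ := (continuous_quadX.comp hZc).add (continuous_quadY.comp hZc)
  have hlev : rawLevel q = ℓ := funext fun t ↦ by simp only [rawLevel, hZ, hℓ]
  have hreach : ∀ d : ℝ≥0, N ≤ runLevel d q ↔ ∃ r ≤ d, N ≤ ℓ r := by
    intro d
    rw [runLevel, hlev, ← not_lt, pathRunMax_lt_iff hℓc]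
    push Not
    rfl
  simp only [reachEvent, mem_iUnion, reachSet, mem_setOf_eq, hreach, Finset.mem_range, exists_prop]
  constructor
  · rintro ⟨n, k, -, r, -, hr⟩; exact ⟨r, hr⟩
  · rintro ⟨t, ht⟩
    obtain ⟨n, hn⟩ := exists_nat_gt (t : ℝ)
    refine ⟨n, n * 2 ^ n, Nat.lt_succ_self _, t, ?_, ht⟩
    rw [← NNReal.coe_le_coe]; push_cast
    rw [le_div_iff₀ (by positivity)]
    have h2 : (1 : ℝ) ≤ 2 ^ n := one_le_pow₀ (by norm_num)
    nlinarith [NNReal.coe_nonneg t]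

/-! ### Canonical side: convergence of the skeleton functionals -/

/-- **On the canonical space**, `approxPos N n (pairPath ω) → hitPos N ω` whenever the opposite
side is reached. [folklore] -/
theorem tendsto_approxPos_pairPath {N : ℝ} (hN : 0 < N) {ω : WienerPair} (hω : canHit N ω ≠ ⊤) :
    Tendsto (fun n ↦ approxPos N n (pairPath ω)) atTop (𝓝 (hitPos N ω)) := by
  refine tendsto_approxPos (Zc := (canORBM · ω)) (continuous_canORBM ω) (fun t ↦ (canORBM_eq_rawORBM t ω).symm)
    (canLevel_hitPos hN hω) fun t ht ↦ ?_
  have hlt : (t : WithTop ℝ≥0) < canHit N ω := by rw [canHit_eq_coe_hitTime hω]; exact_mod_cast ht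
  exact canLevel_lt_of_coe_lt_canHit hlt

/-- On the canonical space the skeleton reaching event is `{T_N < ∞}`. [folklore] -/
theorem pairPath_mem_reachEvent_iff {N : ℝ} (hN : 0 < N) (ω : WienerPair) :
    pairPath ω ∈ reachEvent N ↔ canHit N ω ≠ ⊤ := by
  rw [mem_reachEvent_iff (Zc := (canORBM · ω)) (continuous_canORBM ω) (fun t ↦ (canORBM_eq_rawORBM t ω).symm)]
  constructor
  · rintro ⟨t, ht⟩ htop
    have := canHit_le_of_le_canLevel (N := N) (ω := ω) (t := t) ht
    rw [htop] at this
    exact absurd this (not_le.2 (WithTop.coe_lt_top t))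
  · intro h
    exact ⟨hitTime N ω, (canLevel_hitTime hN h).ge⟩

/-- Auxiliary statement (`wienerPair_reachEvent`). [folklore] -/
theorem ae_pairPath_mem_reachEvent {N : ℝ} (hN : 0 < N) : ∀ᵐ ω ∂wienerPair, pairPath ω ∈ reachEvent N := by
  filter_upwards [ae_canHit_ne_top N] with ω hω
  exact (pairPath_mem_reachEvent_iff hN ω).2 hω

/-! ### General solutions: the driving pair and its law -/

section Transfer

variable {Ω : Type} [MeasurableSpace Ω] {P : Measure Ω} {B Z : ℝ≥0 → Ω → ℂ} {ℓ₁ ℓ₂ : ℝ≥0 → Ω → ℝ}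

/-- The measurable version `B' = Z − ζ ℓ¹ − ℓ²` of the driving Brownian motion. [folklore] -/
def driveM (Z : ℝ≥0 → Ω → ℂ) (ℓ₁ ℓ₂ : ℝ≥0 → Ω → ℝ) (t : ℝ≥0) (ω : Ω) : ℂ :=
  Z t ω - dirSixty * ((ℓ₁ t ω : ℝ) : ℂ) - ((ℓ₂ t ω : ℝ) : ℂ)

/-- Auxiliary statement (`measurable_driveM`). [folklore] -/
theorem measurable_driveM (h : IsORBMSixty B Z ℓ₁ ℓ₂ P) (t : ℝ≥0) : Measurable (driveM Z ℓ₁ ℓ₂ t) := by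
  unfold driveM
  exact ((h.measurable t).sub ((Complex.measurable_ofReal.comp (h.measurable_ℓ₁ t)).const_mul _)).sub
    (Complex.measurable_ofReal.comp (h.measurable_ℓ₂ t))

/-- Auxiliary statement (`ae_driveM_eq`). [folklore] -/
theorem ae_driveM_eq (h : IsORBMSixty B Z ℓ₁ ℓ₂ P) : ∀ᵐ ω ∂P, ∀ t, driveM Z ℓ₁ ℓ₂ t ω = B t ω := by
  filter_upwards [h.ae_skorokhod] with ω hω t
  rw [driveM, (hω t).2]; ring

/-- **The pair of driving raw paths** `ω ↦ (re B', im B')`. [folklore] -/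
def drivingPair (Z : ℝ≥0 → Ω → ℂ) (ℓ₁ ℓ₂ : ℝ≥0 → Ω → ℝ) (ω : Ω) : WienerPair :=
  (fun t ↦ (driveM Z ℓ₁ ℓ₂ t ω).re, fun t ↦ (driveM Z ℓ₁ ℓ₂ t ω).im)

/-- Auxiliary statement (`measurable_drivingPair`). [folklore] -/
theorem measurable_drivingPair (h : IsORBMSixty B Z ℓ₁ ℓ₂ P) : Measurable (drivingPair Z ℓ₁ ℓ₂) :=
  (measurable_pi_lambda _ fun t ↦ measurable_re.comp (measurable_driveM h t)).prodMk
    (measurable_pi_lambda _ fun t ↦ measurable_im.comp (measurable_driveM h t))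

omit [MeasurableSpace Ω] in
/-- Auxiliary statement (`zPath_drivingPair`). [folklore] -/
theorem zPath_drivingPair (ω : Ω) (t : ℝ≥0) : zPath (drivingPair Z ℓ₁ ℓ₂ ω) t = driveM Z ℓ₁ ℓ₂ t ω := by
  simp [zPath, drivingPair, Complex.re_add_im]

/-- **The law of the driving pair is `wienerPair`** (independence of the coordinates and uniqueness
of the pre-Wiener law). [folklore] -/
theorem map_drivingPair [IsProbabilityMeasure P] (h : IsORBMSixty B Z ℓ₁ ℓ₂ P) :
    P.map (drivingPair Z ℓ₁ ℓ₂) = wienerPair := by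
  set X : Ω → (ℝ≥0 → ℝ) := fun ω t ↦ (driveM Z ℓ₁ ℓ₂ t ω).re with hX
  set Y : Ω → (ℝ≥0 → ℝ) := fun ω t ↦ (driveM Z ℓ₁ ℓ₂ t ω).im with hY
  have hXm : Measurable X := measurable_pi_lambda _ fun t ↦ measurable_re.comp (measurable_driveM h t)
  have hYm : Measurable Y := measurable_pi_lambda _ fun t ↦ measurable_im.comp (measurable_driveM h t)
  have hae := ae_driveM_eq h
  have hXae : (fun ω t ↦ (B t ω).re) =ᵐ[P] X := hae.mono fun ω hω ↦ funext fun t ↦ by simp only [hX, hω t]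
  have hYae : (fun ω t ↦ (B t ω).im) =ᵐ[P] Y := hae.mono fun ω hω ↦ funext fun t ↦ by simp only [hY, hω t]
  have hind : IndepFun X Y P := h.isBrownianComplex.indepFun.congr hXae hYae
  have hprod := (indepFun_iff_map_prod_eq_prod_map_map hXm.aemeasurable hYm.aemeasurable).1 hind
  -- the two marginal path laws are the pre-Wiener measure
  have hXpre : IsPreBrownianReal (fun t ω ↦ (driveM Z ℓ₁ ℓ₂ t ω).re) P :=
    h.isBrownianComplex.re.toIsPreBrownianReal.congr fun t ↦ hae.mono fun ω hω ↦ by simp only [hω t]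
  have hYpre : IsPreBrownianReal (fun t ω ↦ (driveM Z ℓ₁ ℓ₂ t ω).im) P :=
    h.isBrownianComplex.im.toIsPreBrownianReal.congr fun t ↦ hae.mono fun ω hω ↦ by simp only [hω t]
  have heval := isPreBrownianReal_eval isProjectiveLimit_preWienerMeasure_holds
  have hXlaw : P.map X = preWienerMeasure := by
    have := IsPreBrownianReal.map_path_eq hXpre heval (fun t ↦ measurable_re.comp (measurable_driveM h t))
      (fun t ↦ measurable_pi_apply t)
    rw [hX, this]; exact Measure.map_id
  have hYlaw : P.map Y = preWienerMeasure := by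
    have := IsPreBrownianReal.map_path_eq hYpre heval (fun t ↦ measurable_im.comp (measurable_driveM h t))
      (fun t ↦ measurable_pi_apply t)
    rw [hY, this]; exact Measure.map_id
  have hpair : drivingPair Z ℓ₁ ℓ₂ = fun ω ↦ (X ω, Y ω) := rfl
  rw [hpair, hprod, hXlaw, hYlaw]
  rfl

/-! ### General solutions: the reflected process as the skeleton image, hitting, transfer -/

/-- **Good paths**: almost surely the reflected path is continuous, lives in the closed wedge, starts
at the vertex, and is the dyadic Skorokhod image of the driving pair. [folklore] -/
theorem ae_orbmGoodPath (h : IsORBMSixty B Z ℓ₁ ℓ₂ P) : ∀ᵐ ω ∂P, Continuous (Z · ω) ∧ (∀ t, Z t ω ∈ closedWedge (π / 3)) ∧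
    Z 0 ω = 0 ∧ ∀ t, rawORBM (drivingPair Z ℓ₁ ℓ₂ ω) t = Z t ω := by
  filter_upwards [h.ae_continuous, h.ae_skorokhod, h.ae_eq_skorokhodMap, ae_driveM_eq h, h.ae_continuous_driving,
    h.ae_driving_zero, h.ae_monotone] with ω hc hsk hmap hdrive hBc hB0 hmono
  refine ⟨hc.1, fun t ↦ (hsk t).1, ?_, fun t ↦ ?_⟩
  · rw [(hsk 0).2, hB0, hmono.1, hmono.2.1]; simp
  · have h1 : Continuous (drivingPair Z ℓ₁ ℓ₂ ω).1 := by
      show Continuous fun t ↦ (driveM Z ℓ₁ ℓ₂ t ω).re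
      simp only [hdrive]; exact continuous_re.comp hBc
    have h2 : Continuous (drivingPair Z ℓ₁ ℓ₂ ω).2 := by
      show Continuous fun t ↦ (driveM Z ℓ₁ ℓ₂ t ω).im
      simp only [hdrive]; exact continuous_im.comp hBc
    rw [rawORBM_eq_skMap h1 h2, skMap]
    simp only [zPath_drivingPair, hdrive]
    rw [hmap t]

/-- The level of the reflected process. [folklore] -/
def levelZ (Z : ℝ≥0 → Ω → ℂ) (t : ℝ≥0) (ω : Ω) : ℝ := quadX (Z t ω) + quadY (Z t ω)

/-- **The hitting time of the opposite side** by the reflected process (junk `0` if never).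
[folklore] -/
def hitTimeZ (Z : ℝ≥0 → Ω → ℂ) (N : ℝ) (ω : Ω) : ℝ≥0 := (exitTime (levelZ Z) (-1) N ω).untopD 0

/-- Almost surely the opposite side is reached: the skeleton reaching event has probability one
(its law is that of the canonical pair). [folklore] -/
theorem ae_mem_reachEvent [IsProbabilityMeasure P] (h : IsORBMSixty B Z ℓ₁ ℓ₂ P) {N : ℝ} (hN : 0 < N) :
    ∀ᵐ ω ∂P, drivingPair Z ℓ₁ ℓ₂ ω ∈ reachEvent N := by
  have hmeas := measurable_drivingPair h
  have hE := measurableSet_reachEvent N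
  have h1 : P (drivingPair Z ℓ₁ ℓ₂ ⁻¹' (reachEvent N)ᶜ) = 0 := by
    rw [← Measure.map_apply hmeas hE.compl, map_drivingPair h, ← map_pairPath_wienerPair,
      Measure.map_apply measurable_pairPath hE.compl]
    have : ∀ᵐ ω ∂wienerPair, ω ∉ pairPath ⁻¹' (reachEvent N)ᶜ := by
      filter_upwards [ae_pairPath_mem_reachEvent hN] with ω hω
      simpa using hω
    exact measure_eq_zero_iff_ae_notMem.2 this
  rw [ae_iff]
  exact h1

/-- **Almost surely**: the hitting time is a genuine first hitting time of the level `N`, and the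
skeleton functionals of the driving pair converge to the hitting position. [folklore] -/
theorem ae_hit [IsProbabilityMeasure P] (h : IsORBMSixty B Z ℓ₁ ℓ₂ P) {N : ℝ} (hN : 0 < N) :
    ∀ᵐ ω ∂P, levelZ Z (hitTimeZ Z N ω) ω = N ∧ (∀ t < hitTimeZ Z N ω, levelZ Z t ω < N) ∧
      Tendsto (fun n ↦ approxPos N n (drivingPair Z ℓ₁ ℓ₂ ω)) atTop (𝓝 (Z (hitTimeZ Z N ω) ω)) := by
  filter_upwards [ae_orbmGoodPath h, ae_mem_reachEvent h hN] with ω hgood hreach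
  obtain ⟨hZc, hwedge, hZ0, hraw⟩ := hgood
  have hℓc : Continuous fun t ↦ levelZ Z t ω := (continuous_quadX.comp hZc).add (continuous_quadY.comp hZc)
  have hℓ0 : levelZ Z 0 ω ∈ Ioo (-1) N := by
    simp only [levelZ, hZ0, quadX, quadY, zero_re, zero_im, zero_div, sub_zero, mul_zero, add_zero, mem_Ioo]
    exact ⟨by norm_num, hN⟩
  -- finiteness of the exit time from the skeleton event
  obtain ⟨t₀, ht₀⟩ := (mem_reachEvent_iff hZc hraw).1 hreach
  have hfin : exitTime (levelZ Z) (-1) N ω ≠ ⊤ := by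
    intro htop
    have hle : exitTime (levelZ Z) (-1) N ω ≤ t₀ :=
      (exitTime_le_coe_iff (u := levelZ Z) hℓc).2 ⟨t₀, le_rfl, fun hmem ↦ (not_lt.2 ht₀) hmem.2⟩
    rw [htop] at hle
    exact absurd hle (not_le.2 (WithTop.coe_lt_top t₀))
  obtain ⟨T, hT⟩ := WithTop.ne_top_iff_exists.1 hfin
  have hTeq : hitTimeZ Z N ω = T := by rw [hitTimeZ, ← hT, WithTop.untopD_coe]
  have hlevT : levelZ Z T ω = N := by
    rcases apply_eq_or_eq_of_exitTime_eq_coe (u := levelZ Z) hℓc hℓ0 hT.symm with h1 | h1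
    · exfalso
      have : 0 ≤ levelZ Z T ω := add_nonneg (quadX_nonneg_of_mem_closedWedge (hwedge T)) (quadY_nonneg_of_mem_closedWedge (hwedge T))
      linarith
    · exact h1
  have hbefore : ∀ t < T, levelZ Z t ω < N := fun t ht ↦ by
    have hlt : (t : WithTop ℝ≥0) < exitTime (levelZ Z) (-1) N ω := by rw [← hT]; exact_mod_cast ht
    exact (mem_Ioo_of_coe_lt_exitTime hlt).2
  rw [hTeq]
  exact ⟨hlevT, hbefore, tendsto_approxPos hZc hraw hlevT hbefore⟩

/-- **The hitting position of a general solution has the law of the canonical one**: for every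
bounded continuous `g`, `E_P[g(Z_{T_N})] = ∫ g d(uniformOppositeSide N)`. [folklore] -/
theorem integral_comp_hitPos_eq [IsProbabilityMeasure P] (h : IsORBMSixty B Z ℓ₁ ℓ₂ P) {N : ℝ} (hN : 0 < N) (g : ℂ →ᵇ ℝ) :
    ∫ ω, g (Z (hitTimeZ Z N ω) ω) ∂P = ∫ z, g z ∂(uniformOppositeSide N) := by
  have hmeas := measurable_drivingPair h
  -- the common sequence of skeleton expectations
  have hseq : ∀ n, ∫ ω, g (approxPos N n (drivingPair Z ℓ₁ ℓ₂ ω)) ∂P = ∫ ω, g (approxPos N n (pairPath ω)) ∂wienerPair := by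
    intro n
    have hgm : Measurable fun q ↦ g (approxPos N n q) := g.continuous.measurable.comp (measurable_approxPos N n)
    rw [← integral_map hmeas.aemeasurable hgm.aestronglyMeasurable, map_drivingPair h, ← map_pairPath_wienerPair,
      integral_map measurable_pairPath.aemeasurable hgm.aestronglyMeasurable, map_pairPath_wienerPair]
  -- limits on both sides (bounded convergence)
  have hP : Tendsto (fun n ↦ ∫ ω, g (approxPos N n (drivingPair Z ℓ₁ ℓ₂ ω)) ∂P) atTop (𝓝 (∫ ω, g (Z (hitTimeZ Z N ω) ω) ∂P)) := by
    refine tendsto_integral_of_dominated_convergence (fun _ ↦ ‖g‖)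
      (fun n ↦ (g.continuous.measurable.comp ((measurable_approxPos N n).comp hmeas)).aestronglyMeasurable)
      (integrable_const _) (fun n ↦ ae_of_all _ fun ω ↦ g.norm_coe_le_norm _) ?_
    filter_upwards [ae_hit h hN] with ω hω
    exact (g.continuous.tendsto _).comp hω.2.2
  have hW : Tendsto (fun n ↦ ∫ ω, g (approxPos N n (pairPath ω)) ∂wienerPair) atTop (𝓝 (∫ ω, g (hitPos N ω) ∂wienerPair)) := by
    refine tendsto_integral_of_dominated_convergence (fun _ ↦ ‖g‖)
      (fun n ↦ (g.continuous.measurable.comp ((measurable_approxPos N n).comp measurable_pairPath)).aestronglyMeasurable)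
      (integrable_const _) (fun n ↦ ae_of_all _ fun ω ↦ g.norm_coe_le_norm _) ?_
    filter_upwards [ae_canHit_ne_top N] with ω hω
    exact (g.continuous.tendsto _).comp (tendsto_approxPos_pairPath hN hω)
  have heq : ∫ ω, g (Z (hitTimeZ Z N ω) ω) ∂P = ∫ ω, g (hitPos N ω) ∂wienerPair := by
    refine tendsto_nhds_unique hP ?_
    simp_rw [hseq]; exact hW
  rw [heq, ← (hasLaw_hitPos hN).map_eq, integral_map (measurable_hitPos N).aemeasurable g.continuous.measurable.aestronglyMeasurable]

/-- Auxiliary statement (`aemeasurable_hitPosZ`). [folklore] -/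
theorem aemeasurable_hitPosZ [IsProbabilityMeasure P] (h : IsORBMSixty B Z ℓ₁ ℓ₂ P) {N : ℝ} (hN : 0 < N) :
    AEMeasurable (fun ω ↦ Z (hitTimeZ Z N ω) ω) P :=
  aemeasurable_of_tendsto_metrizable_ae atTop
    (fun n ↦ ((measurable_approxPos N n).comp (measurable_drivingPair h)).aemeasurable)
    ((ae_hit h hN).mono fun _ hω ↦ hω.2.2)

/-- **The law of the hitting position of a general solution is uniform on the opposite side.**
[folklore] -/
theorem hasLaw_hitPosZ [IsProbabilityMeasure P] (h : IsORBMSixty B Z ℓ₁ ℓ₂ P) {N : ℝ} (hN : 0 < N) :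
    HasLaw (fun ω ↦ Z (hitTimeZ Z N ω) ω) (uniformOppositeSide N) P := by
  have hae := aemeasurable_hitPosZ h hN
  refine ⟨hae, ?_⟩
  haveI : IsProbabilityMeasure (P.map fun ω ↦ Z (hitTimeZ Z N ω) ω) := Measure.isProbabilityMeasure_map hae
  refine ext_of_forall_integral_eq_of_IsFiniteMeasure fun g ↦ ?_
  rw [integral_map hae g.continuous.measurable.aestronglyMeasurable]
  exact integral_comp_hitPos_eq h hN g

/-- **The hitting event, almost surely**: `Z_{T_N}` lies on the opposite side and no earlier position
does. [folklore] -/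
theorem ae_hitPosZ_mem [IsProbabilityMeasure P] (h : IsORBMSixty B Z ℓ₁ ℓ₂ P) {N : ℝ} (hN : 0 < N) :
    ∀ᵐ ω ∂P, Z (hitTimeZ Z N ω) ω ∈ oppositeSide N ∧ ∀ t < hitTimeZ Z N ω, Z t ω ∉ oppositeSide N := by
  filter_upwards [ae_hit h hN, ae_orbmGoodPath h] with ω hω hgood
  obtain ⟨hlev, hbefore, -⟩ := hω
  refine ⟨(mem_oppositeSide_iff hN (hgood.2.1 _)).2 hlev, fun t ht hmem ↦ ?_⟩
  have h1 := hbefore t ht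
  have h2 := (mem_oppositeSide_iff hN (hgood.2.1 t)).1 hmem
  rw [levelZ] at h1
  linarith

end Transfer

/-! ### The named fact -/

/-- **Uniform hitting distribution of `ORBM_{π/3}` started from the vertex**
(`Literature.Probability.RandomPlanarGeometry.LawlerSchrammWerner2001_orbm_uniformHitting` holds): for every solution of
the Skorokhod problem `IsORBMSixty` on a probability space and every level `N > 0`, the hitting
time `T_N` of the opposite side `[N, Nζ]` is a.s. a first hitting time and the hitting position
`Z_{T_N}` has the uniform law on the side. Proof: the Skorokhod representation reduces to the
canonical model; there, a stopped Dynkin identity for an explicit family of oblique harmonic test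
functions (Schwarz–Christoffel uniformisation of the equilateral triangle, Carleson/Euler beta
identity) identifies the law. Lawler–Schramm–Werner, *Acta Math.* 187 (2001), §3; Dubédat,
*Ann. IHP* 40 (2004), §4, Prop. 1; Werner, LNM 1840 (2004), Ch. 5 Lemma 5.3.
[cite: Dubedat2004, §4 Proposition 1] -/
theorem LawlerSchrammWerner2001_orbm_uniformHitting_holds : LawlerSchrammWerner2001_orbm_uniformHitting := by
  intro Ω _ P _ B Z ℓ₁ ℓ₂ h N hN
  exact ⟨hitTimeZ Z N, ae_hitPosZ_mem h hN, hasLaw_hitPosZ h hN⟩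

end Literature.Probability.RandomPlanarGeometry
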